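import Literature.Analysis.ValidatedNumerics.IntervalFunctions
import Literature.Analysis.ValidatedNumerics.BoxInfeasibility
import HarnessLib

/-!
# Box infeasibility certificates for `RExpr` systems (with `x²`, `x⁻¹`, `√x`, `min`, `max`)

Topic `Literature/Analysis/ValidatedNumerics`.  The `RExpr` version of `BoxInfeasibility.lean`
(as `kdRBoundVerifier` of `IntervalFunctions.lean` is the `RExpr` version of `kdBoundVerifier`):
a system `g ≥ 0 (g ∈ gs)`, `h = 0 (h ∈ hs)` of `RExpr` constraints has no real solution in a
rational box if a kd-tree subdivision excludes every cell by the partial natural interval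
extension `RExpr.enclose` (a cell where some extension is undefined — a reciprocal of an interval
containing `0` — is simply not excluded).

* `rinfeasLeaf gs hs B (prec, iters)` and `rinfeasLeaf_sound`;
* `RInfeasClaim`, `RInfeasClaim.Holds`, `kdRInfeasVerifier`, `RInfeasClaim.holds_of_check`;
* kernel example: `√x + √y = 1`, `x ≥ 9/25`, `y ≥ 9/25` has no solution in `[0, 1]²`.

This is the certificate format of the polygon/cluster lemmas of the robust kissing classification
(`Summits/AtomisticToContinuum/…/TwoCentreKissingKernelRobustTangencyBound*`), whose corner cosines
are quotients `N/D` with `D` a square root.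
-/

namespace Literature.Analysis.ValidatedNumerics

open NonemptyInterval

/-- Exclusion test for one `RExpr` inequality `g ≥ 0` on a box: the extension is defined and its
right end is `< 0`. [cite: Moore1966, Theorem 3.1, §4.4] -/
def rexcludesGe (g : RExpr) (B : Box) (pi : ℕ × ℕ) : Bool :=
  match g.enclose pi.1 pi.2 B.toIvl with
  | some I => decide (I.snd < 0)
  | none => false

/-- Exclusion test for one `RExpr` equation `h = 0` on a box: the extension is defined and lies on
one side of `0`. [cite: Moore1966, Theorem 3.1, §4.4] -/
def rexcludesEq (h : RExpr) (B : Box) (pi : ℕ × ℕ) : Bool :=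
  match h.enclose pi.1 pi.2 B.toIvl with
  | some I => decide (I.snd < 0) || decide (0 < I.fst)
  | none => false

/-- Soundness of `rexcludesGe`. [cite: Moore1966, Theorem 3.1] -/
theorem not_ge_of_rexcludesGe {g : RExpr} {B : Box} {pi : ℕ × ℕ} (h : rexcludesGe g B pi = true)
    (x : ℕ → ℝ) (hx : B.mem x) : ¬ 0 ≤ g.eval x := by
  unfold rexcludesGe at h
  split at h
  · rename_i I hI
    have hm := (mem_ratCast_iff.1 (RExpr.eval_mem_enclose (fun i ↦ Box.mem_toIvl hx i) g hI)).2
    have h2 : ((I.snd : ℚ) : ℝ) < 0 := by exact_mod_cast of_decide_eq_true h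
    intro h0
    linarith
  · exact absurd h Bool.false_ne_true

/-- Soundness of `rexcludesEq`. [cite: Moore1966, Theorem 3.1] -/
theorem ne_zero_of_rexcludesEq {e : RExpr} {B : Box} {pi : ℕ × ℕ} (h : rexcludesEq e B pi = true)
    (x : ℕ → ℝ) (hx : B.mem x) : e.eval x ≠ 0 := by
  unfold rexcludesEq at h
  split at h
  · rename_i I hI
    have hm := mem_ratCast_iff.1 (RExpr.eval_mem_enclose (fun i ↦ Box.mem_toIvl hx i) e hI)
    intro h0
    rw [h0] at hm
    rw [Bool.or_eq_true] at h
    rcases h with h | h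
    · have h2 : ((I.snd : ℚ) : ℝ) < 0 := by exact_mod_cast of_decide_eq_true h
      linarith [hm.2]
    · have h2 : (0 : ℝ) < (I.fst : ℚ) := by exact_mod_cast of_decide_eq_true h
      linarith [hm.1]
  · exact absurd h Bool.false_ne_true

/-- **Exclusion test on a box for an `RExpr` system** (leaf datum `(precision, Heron steps)`).
[cite: Moore1966, Theorem 3.1, §4.4] -/
def rinfeasLeaf (gs hs : List RExpr) (B : Box) (pi : ℕ × ℕ) : Bool :=
  gs.any (fun g => rexcludesGe g B pi) || hs.any (fun h => rexcludesEq h B pi)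

/-- **Soundness of the exclusion test.** [cite: Moore1966, Theorem 3.1] -/
theorem rinfeasLeaf_sound {gs hs : List RExpr} {B : Box} {pi : ℕ × ℕ}
    (h : rinfeasLeaf gs hs B pi = true) (x : ℕ → ℝ) (hx : B.mem x) :
    ¬ ((∀ g ∈ gs, 0 ≤ g.eval x) ∧ (∀ e ∈ hs, e.eval x = 0)) := by
  rintro ⟨hg, he⟩
  rw [rinfeasLeaf, Bool.or_eq_true, List.any_eq_true, List.any_eq_true] at h
  rcases h with ⟨g, hgm, hlt⟩ | ⟨e, hem, hlt⟩
  · exact not_ge_of_rexcludesGe hlt x hx (hg g hgm)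
  · exact ne_zero_of_rexcludesEq hlt x hx (he e hem)

/-- **No solution in a box, from a kd-tree.** [cite: Moore1966, Theorem 3.1, §4.4] -/
theorem not_rsol_of_kdCheck {gs hs : List RExpr} {B : Box} {t : KdCert (ℕ × ℕ)}
    (h : t.check (rinfeasLeaf gs hs) B = true) (x : ℕ → ℝ) (hx : B.mem x) :
    ¬ ((∀ g ∈ gs, 0 ≤ g.eval x) ∧ (∀ e ∈ hs, e.eval x = 0)) :=
  KdCert.sound (P := fun x => ¬ ((∀ g ∈ gs, 0 ≤ g.eval x) ∧ (∀ e ∈ hs, e.eval x = 0)))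
    (fun _ _ hl x hx ↦ rinfeasLeaf_sound hl x hx) t B h x hx

/-- An **infeasibility claim for an `RExpr` system**: `g ≥ 0 (g ∈ gs)`, `h = 0 (h ∈ hs)` has no
real solution in the rational box `box`. [folklore] -/
structure RInfeasClaim where
  /-- the inequality constraints `g ≥ 0` -/
  gs : List RExpr
  /-- the equality constraints `h = 0` -/
  hs : List RExpr
  /-- the box -/
  box : Box

/-- The proposition asserted by an `RInfeasClaim`. [folklore] -/
def RInfeasClaim.Holds (c : RInfeasClaim) : Prop :=
  ∀ x : ℕ → ℝ, c.box.mem x → ¬ ((∀ g ∈ c.gs, 0 ≤ g.eval x) ∧ (∀ e ∈ c.hs, e.eval x = 0))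

/-- **The subdividing infeasibility verifier for `RExpr` systems.** [cite: Moore1966, Theorem 3.1, §4.4] -/
def kdRInfeasVerifier : Verifier RInfeasClaim RInfeasClaim.Holds where
  Cert := KdCert (ℕ × ℕ)
  check c t := t.check (rinfeasLeaf c.gs c.hs) c.box
  sound _ _ h x hx := not_rsol_of_kdCheck h x hx

/-- The checker of `kdRInfeasVerifier`, unfolded. [folklore] -/
@[simp] theorem kdRInfeasVerifier_check (c : RInfeasClaim) (t : KdCert (ℕ × ℕ)) :
    kdRInfeasVerifier.check c t = t.check (rinfeasLeaf c.gs c.hs) c.box := rfl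

/-- **Soundness of `kdRInfeasVerifier`** in the statement shape of `Certificate.lean`.
[cite: Moore1966, Theorem 3.1, §4.4] -/
theorem RInfeasClaim.holds_of_check (c : RInfeasClaim) (t : KdCert (ℕ × ℕ))
    (h : kdRInfeasVerifier.check c t = true) : c.Holds :=
  kdRInfeasVerifier.claim t h

/-- Kernel example: `√x + √y − 1 = 0`, `x − 9/25 ≥ 0`, `y − 9/25 ≥ 0` has no solution in `[0,1]²`
(`√x + √y ≥ 6/5` there); one bisection per axis at `7/20` excludes every cell. -/
example : RInfeasClaim.Holds
    ⟨[.sub (.var 0) (.const (9/25)), .sub (.var 1) (.const (9/25))],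
     [.sub (.add (.sqrt (.var 0)) (.sqrt (.var 1))) (.const 1)],
     [(0, 1), (0, 1)]⟩ :=
  RInfeasClaim.holds_of_check _
    (.split 0 (7/20) (.leaf (20, 8)) (.split 1 (7/20) (.leaf (20, 8)) (.leaf (20, 8))))
    (by decide +kernel)

end Literature.Analysis.ValidatedNumerics
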